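import Summits.AtomisticToContinuum.FouriersLaw.Theorems.BondHeatUncertaintyBoundedResponseBathHeatD

/-!
# BondHeatUncertainty / BoundedResponse — «BathHeat», part E: §4 the door in bath-heat currency (`bathTail`, (BHᴾ), (BTᶠ), (BTᶜ), Einstein–Helfand split, `11071 ⟸ (BHᴾ_1) ∧ (BTᶠ_1)`)
(lens-1 g107 NODE 107 `…BathHeat.lean` sha256 128247e61f0c3dd6…, 1464 l, cut at section boundaries under the 400-line cap by hand-2 g39 for landing: A = §0 (l.1–266),
B = §1 (l.268–492), C = §2 (l.494–617), D = §3 (l.619–867), E = §4 (l.869–1214), main = §5 (l.1216–1462); bodies byte-verbatim, header l.92–107 repeated; full module docstring in part A.) -/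

noncomputable section

open MeasureTheory ProbabilityTheory Filter Topology Set Function
open scoped NNReal ENNReal
open Literature.MathematicalPhysics.KineticTheory.HeatConduction
open Literature.MathematicalPhysics.KineticTheory OscillatorChain
open Literature.Probability.Process
open Summit.AtomisticToContinuum.FouriersLaw.Theorems.SubdiffusiveBondHeat
open Summit.AtomisticToContinuum.FouriersLaw.Theorems.SubdiffusiveBondHeat.EscapeGrading
open Summit.AtomisticToContinuum.FouriersLaw.Theorems.OddSectorIrreversibility

namespace Summit.AtomisticToContinuum.FouriersLaw.Theorems.BoundedResponse.HeatSpreading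

open Summit.AtomisticToContinuum.FouriersLaw.Theorems.BoundedResponse.TransientContact
open Summit.AtomisticToContinuum.FouriersLaw.Theorems.BoundedResponse.ParityFloor (extensiveBlockEnergyVariance_holds)
open Summit.AtomisticToContinuum.FouriersLaw.Theses.BondHeatUncertainty (BoundedResponse SubdiffusiveBondHeat)

/-! ## §4 The door in bath-heat currency: `11071 ⟸ (BHᴾ_1) ∧ (BTᶠ_1)` EXACTLY; `(BTᶠ_1) ⟸ 11071`; `(BHᴾ_1) ⟺ (HSᴾ_3) ⟸ (S)` -/

/-- **The bath Green–Kubo TAIL functional `B_N(t) := γ² ∫_{(0,∞)} min(r,t)·K_N(r) dr`** — the `min`-weighted mass of the kinetic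
memory kernel; the bath twin of `gkTail` (`Tr_N`), with the opposite natural sign (`W_N/2 = tγT²E_N + B_N(t)` vs `V_N/2 = tG_N − Tr_N(t)`).
[formal bookkeeping] -/
def bathTail (ω₂ lam β γ T : ℝ) (N : ℕ) (t : ℝ) : ℝ :=
  γ ^ 2 * ∫ r in Ioi (0 : ℝ), min r t * bathKinCorr ω₂ lam β γ T N r

/-- **(BHᴾ_h) `BathHeatPoint h`** — the BATH HEAT VARIANCE at the Thouless time is `O(N^h)`: `∃ C, c > 0, N₀: ∀ N ≥ N₀,
W_N(cN²) ≤ C·N^h` (shape of `HeatSpreadPoint`).  Ladder: `h = 3` free (`⟺ HSᴾ_5`), `h = 2` phonon-compatible, `h = 1` = normal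
(Fourier) heat exchange with ONE bath, `⟺ HSᴾ_3` (`heatSpreadPoint_iff_bathHeatPoint`), hence TRUE-leaning (`⟸ (S)`) and phonon-FALSE.
Tag: UNDECIDED · WEAKER-or-EQUIV (11071 ⟹ BHᴾ_1 open, = 11071 ⟹ HSᴾ_3) · INSTRUMENTABLE (`W_N` is the variance of a single-site functional).
[route statement · this cell; NOT a literature fact] -/
def BathHeatPoint (h : ℝ) : Prop :=
  ∀ ω₂ lam β γ : ℝ, 0 < ω₂ → 0 < lam → 0 < β → 0 < γ → ∀ T : ℝ, 0 < T →
    ∃ C c : ℝ, 0 < c ∧ ∃ N₀ : ℕ, ∀ N : ℕ, N₀ ≤ N →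
      bathHeatVar ω₂ lam β γ T N (c * (N : ℝ) ^ 2) ≤ C * (N : ℝ) ^ h

/-- **(BTᶠ_g) `BathTailFloor g`** — FLOOR on the bath tail functional at the Thouless time: `∀ c > 0 ∃ C N₀ ∀ N ≥ N₀,
B_N(cN²) ≥ −C·N^g` («the kinetic memory kernel `K_N` of the bath site has no NEGATIVE `min(r,cN²)`-weighted mass beyond `O(N^{g})/γ²`»).
`g = 2` free (`bathTailFloor_two`); `g = 1` NECESSARY for 11071 (`bathTailFloor_one_of_boundedResponse`) and, with (BHᴾ_1), SUFFICIENT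
(`boundedResponse_of_bathHeatPoint_bathTailFloor`).  Phonon-compatible (harmonic chain: `K_N` integrable with an integrable first moment,
`B_N = O(1)` expected).  Tag: WEAKER (⟸ 11071, proved) · UNDECIDED unconditionally · TRUE-leaning · INSTRUMENTABLE (one scalar kernel).
[route statement · this cell; NOT a literature fact] -/
def BathTailFloor (g : ℝ) : Prop :=
  ∀ ω₂ lam β γ : ℝ, 0 < ω₂ → 0 < lam → 0 < β → 0 < γ → ∀ T : ℝ, 0 < T → ∀ c : ℝ, 0 < c →
    ∃ C : ℝ, ∃ N₀ : ℕ, ∀ N : ℕ, N₀ ≤ N → -(C * (N : ℝ) ^ g) ≤ bathTail ω₂ lam β γ T N (c * (N : ℝ) ^ 2)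

/-- **(BTᶜ_g) `BathTailCeiling g`** — CEILING on the bath tail functional: `∀ c > 0 ∃ C N₀ ∀ N ≥ N₀, B_N(cN²) ≤ C·N^g`.  Free given (BHᴾ_g)
(`B_N ≤ W_N/2`, `bathTailCeiling_of_bathHeatPoint`); with 11071 it returns (BHᴾ_1) (`bathHeatPoint_one_of_boundedResponse_bathTailCeiling`) — the
bath twin of `GKTailFloor 3`.  Tag: UNDECIDED · TRUE-leaning · phonon-compatible. [route statement · this cell; NOT a literature fact] -/
def BathTailCeiling (g : ℝ) : Prop :=
  ∀ ω₂ lam β γ : ℝ, 0 < ω₂ → 0 < lam → 0 < β → 0 < γ → ∀ T : ℝ, 0 < T → ∀ c : ℝ, 0 < c →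
    ∃ C : ℝ, ∃ N₀ : ℕ, ∀ N : ℕ, N₀ ≤ N → bathTail ω₂ lam β γ T N (c * (N : ℝ) ^ 2) ≤ C * (N : ℝ) ^ g

section Door

variable {ω₂ lam β γ : ℝ} (hω : 0 < ω₂) (hl : 0 < lam) (hβ : 0 < β) (hγ : 0 < γ) {T : ℝ} (hT : 0 < T)
include hω hl hβ hγ hT

/-- The kinetic kernel facts (tree, `BoundaryKernelBasics` (b)(c)(e)): `K_N` is continuous, `|K_N| ≤ 2T²`, `K_N ∈ L¹(0,∞)` (`N ≥ 1`).
[folklore] -/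
theorem bathKinCorr_basics {N : ℕ} (hN : 0 < N) :
    Continuous (bathKinCorr ω₂ lam β γ T N) ∧ (∀ u : ℝ, |bathKinCorr ω₂ lam β γ T N u| ≤ 2 * T ^ 2) ∧
      IntegrableOn (bathKinCorr ω₂ lam β γ T N) (Ioi 0) := by
  obtain ⟨-, hKc, habs, -, hL1⟩ := boundaryKernelBasics_proof ω₂ lam β γ hω hl hβ hγ T hT N hN
  exact ⟨hKc, habs, hL1⟩

/-- ★ **The bath Einstein–Helfand identity `W_N(t)/2 = t·γT²·E_N + B_N(t)`** (`N ≥ 1`, `t ≥ 0`): `t = (t − r)₊ + min(r,t)` against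
`K_N ∈ L¹(0,∞)` and `γT²E_N = γT² − γ²∫₀^∞ K_N`.  The blocker's scalar `E_N` is the LINEAR GROWTH RATE of the bath heat variance.
[folklore mechanism; this cell] -/
theorem bathHeatVar_eq_escapeDeficit_add_bathTail {N : ℕ} (hN : 0 < N) {t : ℝ} (ht : 0 ≤ t) :
    bathHeatVar ω₂ lam β γ T N t = 2 * (t * (γ * T ^ 2 * escapeDeficit ω₂ lam β γ T N)) + 2 * bathTail ω₂ lam β γ T N t := by
  have h := TransientBand.integral_min_mul_eq_sub (bathKinCorr_basics hω hl hβ hγ hT hN).2.2 ht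
  unfold bathHeatVar bathTail
  rw [escapeDeficit_eq_bathKinCorr, h]
  have hT0 : T ^ 2 ≠ 0 := by positivity
  field_simp
  ring

/-- `B_N(t) ≥ −t·γT²·E_N ≥ −t·γT²` (`N ≥ 2`, `t ≥ 0`): `W_N ≥ 0` and `E_N ≤ 1`. [folklore] -/
theorem neg_mul_escapeDeficit_le_bathTail {N : ℕ} (hN : 1 < N) {t : ℝ} (ht : 0 ≤ t) :
    -(t * (γ * T ^ 2 * escapeDeficit ω₂ lam β γ T N)) ≤ bathTail ω₂ lam β γ T N t ∧
      -(t * (γ * T ^ 2)) ≤ bathTail ω₂ lam β γ T N t := by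
  have h := bathHeatVar_eq_escapeDeficit_add_bathTail hω hl hβ hγ hT (Nat.zero_lt_of_lt hN) ht
  have hW := bathHeatVar_nonneg hω hl hβ hγ hN hT ht
  have hE1 : escapeDeficit ω₂ lam β γ T N ≤ 1 := escapeDeficit_le_one ω₂ lam β γ hω hl hβ hγ T hT N
  have hγT : 0 ≤ t * (γ * T ^ 2) := by positivity
  constructor
  · linarith
  · nlinarith

/-- `B_N(t) ≤ W_N(t)/2` (`N ≥ 2`, `t ≥ 0`): `E_N ≥ 0`. [folklore] -/
theorem bathTail_le {N : ℕ} (hN : 1 < N) {t : ℝ} (ht : 0 ≤ t) :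
    bathTail ω₂ lam β γ T N t ≤ bathHeatVar ω₂ lam β γ T N t / 2 := by
  have h := bathHeatVar_eq_escapeDeficit_add_bathTail hω hl hβ hγ hT (Nat.zero_lt_of_lt hN) ht
  have hE0 := escapeDeficit_nonneg' hω hl hβ hγ hT (show 2 ≤ N from hN)
  have : 0 ≤ t * (γ * T ^ 2 * escapeDeficit ω₂ lam β γ T N) := by positivity
  linarith

/-- ★ **The two tail functionals differ EXACTLY by the transfer defect**: `Tr_N(t) + (N−1)²·B_N(t) = ((N−1)²·W_N(t) − V_N(t))/2`
(`N ≥ 1`, `t ≥ 0`; both Einstein–Helfand identities and `G_N = γT²(N−1)²E_N`).  By §3 the right side is `O(V_N + (N−1)²W_N + N³)`, so on the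
(S)/(BHᴾ_1) branch (everything `O(N³)`) the grade-3 statements about `Tr_N` and the grade-1 statements about `B_N` are interchangeable up to the
sign flip (ceiling ↔ floor); off that branch the defect is not controlled here (UNDECIDED whether `GKTailFloor 3 ⟺ BathTailCeiling 1`). [this cell] -/
theorem gkTail_add_sq_mul_bathTail_eq {N : ℕ} (hN : 0 < N) {t : ℝ} (ht : 0 ≤ t) :
    gkTail ω₂ lam β γ T N t + ((N : ℝ) - 1) ^ 2 * bathTail ω₂ lam β γ T N t =
      (((N : ℝ) - 1) ^ 2 * bathHeatVar ω₂ lam β γ T N t - heatSpread ω₂ lam β γ T N t) / 2 := by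
  have h1 := mul_totalGK_eq hω hl hβ hγ hT hN ht
  have h2 := bathHeatVar_eq_escapeDeficit_add_bathTail hω hl hβ hγ hT hN ht
  have h3 := totalGK_eq hω hl hβ hγ hT hN
  have h4 : ((N : ℝ) - 1) ^ 2 * bathHeatVar ω₂ lam β γ T N t =
      2 * (t * (γ * T ^ 2 * ((N : ℝ) - 1) ^ 2 * escapeDeficit ω₂ lam β γ T N)) +
        2 * (((N : ℝ) - 1) ^ 2 * bathTail ω₂ lam β γ T N t) := by
    rw [h2]; ring
  rw [← h3] at h4
  linarith

/-- `B_N(t)/t → 0` as `t → ∞` (each fixed `N ≥ 1`): dominated convergence, `0 ≤ min(r,t)/t ≤ 1`, `min(r,t)/t → 0`, `K_N ∈ L¹(0,∞)`.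
[folklore] -/
theorem tendsto_bathTail_div_atTop {N : ℕ} (hN : 0 < N) :
    Tendsto (fun t : ℝ => bathTail ω₂ lam β γ T N t / t) atTop (𝓝 0) := by
  obtain ⟨hKc, -, hL1⟩ := bathKinCorr_basics hω hl hβ hγ hT hN
  set K := bathKinCorr ω₂ lam β γ T N with hKdef
  -- the normalised integrals tend to `0`
  have hlim : Tendsto (fun t : ℝ => ∫ r in Ioi (0 : ℝ), min r t / t * K r) atTop (𝓝 (∫ r in Ioi (0 : ℝ), (0 : ℝ))) := by
    refine tendsto_integral_filter_of_dominated_convergence (fun r => |K r|) ?_ ?_ hL1.abs ?_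
    · exact Eventually.of_forall fun t =>
        (((continuous_id.min continuous_const).div_const t).mul hKc).aestronglyMeasurable
    · filter_upwards [eventually_gt_atTop (0 : ℝ)] with t ht
      filter_upwards [ae_restrict_mem measurableSet_Ioi] with r hr
      have h0 : 0 ≤ min r t / t := div_nonneg (le_min (le_of_lt hr) ht.le) ht.le
      have h1 : min r t / t ≤ 1 := by rw [div_le_one ht]; exact min_le_right _ _
      rw [Real.norm_eq_abs, abs_mul, abs_of_nonneg h0]
      exact mul_le_of_le_one_left (abs_nonneg _) h1
    · refine Eventually.of_forall fun r => ?_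
      have h : Tendsto (fun t : ℝ => r * t⁻¹ * K r) atTop (𝓝 (r * 0 * K r)) :=
        (tendsto_inv_atTop_zero.const_mul r).mul_const (K r)
      rw [mul_zero, zero_mul] at h
      refine h.congr' ?_
      filter_upwards [eventually_ge_atTop r] with t ht
      rw [min_eq_left ht, div_eq_mul_inv]
  rw [integral_zero] at hlim
  have h2 : Tendsto (fun t : ℝ => γ ^ 2 * ∫ r in Ioi (0 : ℝ), min r t / t * K r) atTop (𝓝 (γ ^ 2 * 0)) :=
    hlim.const_mul _
  rw [mul_zero] at h2
  refine h2.congr' (Eventually.of_forall fun t => ?_)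
  show γ ^ 2 * ∫ r in Ioi (0 : ℝ), min r t / t * K r = bathTail ω₂ lam β γ T N t / t
  unfold bathTail
  rw [← hKdef, mul_div_assoc, ← integral_div]
  refine congrArg (fun x => γ ^ 2 * x) (integral_congr_ae (Eventually.of_forall fun r => ?_))
  show min r t / t * K r = min r t * K r / t
  ring

/-- ★ **EINSTEIN–HELFAND: `W_N(t)/(2t) → γT²·E_N` as `t → ∞`** (each fixed `N ≥ 1`, unconditionally): the blocker's scalar `E_N` IS the
asymptotic diffusivity of the Helfand moment of the bath heat; 11071 reads «the bath-heat diffusivity is `O(1/N)`, reached by the Thouless time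
with an `O(N)` transient» (`= (BHᴾ_1)`, given the floor). [folklore mechanism (Helfand 1960; Gaspard 2022 eq. (3.117)); this cell for the chain] -/
theorem tendsto_bathHeatVar_div_atTop {N : ℕ} (hN : 0 < N) :
    Tendsto (fun t : ℝ => bathHeatVar ω₂ lam β γ T N t / (2 * t)) atTop (𝓝 (γ * T ^ 2 * escapeDeficit ω₂ lam β γ T N)) := by
  have h := (tendsto_bathTail_div_atTop hω hl hβ hγ hT hN).const_add (γ * T ^ 2 * escapeDeficit ω₂ lam β γ T N)
  rw [add_zero] at h
  refine h.congr' ?_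
  filter_upwards [eventually_gt_atTop (0 : ℝ)] with t ht
  rw [bathHeatVar_eq_escapeDeficit_add_bathTail hω hl hβ hγ hT hN ht.le]
  field_simp

omit hω hl hβ hγ hT

/-- ★ **Free rung (BTᶠ_2)** — `B_N(cN²) ≥ −cγT²·N²`. [folklore] -/
theorem bathTailFloor_two : BathTailFloor 2 := by
  intro ω₂ lam β γ hω hl hβ hγ T hT c hc
  refine ⟨c * (γ * T ^ 2), 2, fun N hN => ?_⟩
  have h := (neg_mul_escapeDeficit_le_bathTail hω hl hβ hγ hT (show 1 < N by omega) (t := c * (N : ℝ) ^ 2) (by positivity)).2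
  rw [Real.rpow_two]
  linarith

/-- ★ **NECESSITY — 11071 ⟹ (BTᶠ_1)**: `B_N(cN²) ≥ −cN²γT²·E_N ≥ −cγT²C₁⁺·N` (`W_N ≥ 0` and the Ohmic floor `E_N ≤ C₁/N`). [folklore] -/
theorem bathTailFloor_one_of_boundedResponse (hB : BoundedResponse) : BathTailFloor 1 := by
  intro ω₂ lam β γ hω hl hβ hγ T hT c hc
  obtain ⟨C₁, N₀, hC₁⟩ := (ohmicFloor_iff_boundedResponse.2 hB) ω₂ lam β γ hω hl hβ hγ T hT
  refine ⟨c * (γ * T ^ 2) * max C₁ 0, max N₀ 2, fun N hN => ?_⟩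
  have hNN₀ : N₀ ≤ N := le_trans (le_max_left _ _) hN
  have hN2 : 2 ≤ N := le_trans (le_max_right _ _) hN
  have hNpos : (0 : ℝ) < N := by exact_mod_cast (show 0 < N by omega)
  have hE := hC₁ N hNN₀
  have h := (neg_mul_escapeDeficit_le_bathTail hω hl hβ hγ hT (show 1 < N by omega) (t := c * (N : ℝ) ^ 2) (by positivity)).1
  have hE' : escapeDeficit ω₂ lam β γ T N * N ≤ max C₁ 0 := by
    have h1 : escapeDeficit ω₂ lam β γ T N ≤ max C₁ 0 / N := hE.trans (div_le_div_of_nonneg_right (le_max_left _ _) hNpos.le)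
    rwa [le_div_iff₀ hNpos] at h1
  rw [Real.rpow_one]
  have hcγ : 0 ≤ c * (γ * T ^ 2) := by positivity
  have key : c * (N : ℝ) ^ 2 * (γ * T ^ 2 * escapeDeficit ω₂ lam β γ T N) ≤ c * (γ * T ^ 2) * max C₁ 0 * N := by
    have := mul_le_mul_of_nonneg_left hE' (mul_nonneg hcγ hNpos.le)
    nlinarith
  linarith

/-- ★★ **THE BATH-SIDE DOOR — (BHᴾ_1) ∧ (BTᶠ_1) ⟹ 11071**, EXACT (no transfer error): `cN²·γT²·E_N = W_N(cN²)/2 − B_N(cN²) ≤ (C/2 + C')·N`,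
i.e. the Ohmic floor `E_N ≤ C₁/N`, `⟺ BoundedResponse`. [this cell] -/
theorem boundedResponse_of_bathHeatPoint_bathTailFloor (hP : BathHeatPoint 1) (hF : BathTailFloor 1) : BoundedResponse := by
  refine ohmicFloor_iff_boundedResponse.1 fun ω₂ lam β γ hω hl hβ hγ T hT => ?_
  obtain ⟨C, c, hc, N₀, hCN⟩ := hP ω₂ lam β γ hω hl hβ hγ T hT
  obtain ⟨C', N₁, hC'⟩ := hF ω₂ lam β γ hω hl hβ hγ T hT c hc
  refine ⟨(C / 2 + C') / (c * (γ * T ^ 2)), max N₀ (max N₁ 1), fun N hN => ?_⟩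
  have hNN₀ : N₀ ≤ N := le_trans (le_max_left _ _) hN
  have hNN₁ : N₁ ≤ N := le_trans (le_max_left _ _) (le_trans (le_max_right _ _) hN)
  have hN1 : 1 ≤ N := le_trans (le_max_right _ _) (le_trans (le_max_right _ _) hN)
  have hNpos : (0 : ℝ) < N := by exact_mod_cast hN1
  have hW := hCN N hNN₀
  have hB := hC' N hNN₁
  rw [Real.rpow_one] at hW hB
  have h := bathHeatVar_eq_escapeDeficit_add_bathTail hω hl hβ hγ hT (show 0 < N by omega) (t := c * (N : ℝ) ^ 2) (by positivity)
  have hcγ : 0 < c * (γ * T ^ 2) := by positivity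
  -- `c N² γT² E_N ≤ (C/2 + C') N`
  have key : c * (γ * T ^ 2) * N * (escapeDeficit ω₂ lam β γ T N * N) ≤ (C / 2 + C') * N := by nlinarith
  have key' : c * (γ * T ^ 2) * (escapeDeficit ω₂ lam β γ T N * N) ≤ C / 2 + C' :=
    le_of_mul_le_mul_left (a := (N : ℝ))
      (show (N : ℝ) * (c * (γ * T ^ 2) * (escapeDeficit ω₂ lam β γ T N * N)) ≤ N * (C / 2 + C') by nlinarith [key]) hNpos
  rw [le_div_iff₀ hNpos, le_div_iff₀ hcγ]
  linarith

/-- **11071 modulo (BHᴾ_1)**: given normal bath heat exchange, the blocker IS the bath tail floor. [this cell] -/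
theorem boundedResponse_iff_bathTailFloor_of_bathHeatPoint (hP : BathHeatPoint 1) : BoundedResponse ↔ BathTailFloor 1 :=
  ⟨bathTailFloor_one_of_boundedResponse, boundedResponse_of_bathHeatPoint_bathTailFloor hP⟩

/-- ★ **TRANSFER (HSᴾ_{h+2}) ⟹ (BHᴾ_h)** for `h ≥ 1` (`(N−1)²W_N ≤ 2V_N + C·N³`, `(N−1)² ≥ N²/4`). [this cell] -/
theorem bathHeatPoint_of_heatSpreadPoint {h : ℝ} (hh : 1 ≤ h) (hP : HeatSpreadPoint (h + 2)) : BathHeatPoint h := by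
  intro ω₂ lam β γ hω hl hβ hγ T hT
  obtain ⟨C, c, hc, N₀, hCN⟩ := hP ω₂ lam β γ hω hl hβ hγ T hT
  obtain ⟨C', hC'⟩ := heatSpread_bathHeatVar_compare hω hl hβ hγ hT
  refine ⟨4 * (2 * max C 0 + max C' 0), c, hc, max N₀ 2, fun N hN => ?_⟩
  have hNN₀ : N₀ ≤ N := le_trans (le_max_left _ _) hN
  have hN2 : 2 ≤ N := le_trans (le_max_right _ _) hN
  have hNr : (2 : ℝ) ≤ N := by exact_mod_cast hN2
  have hN1 : (1 : ℝ) ≤ N := by linarith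
  have ht : (0 : ℝ) ≤ c * (N : ℝ) ^ 2 := by positivity
  have hV := hCN N hNN₀
  have h2 := (hC' N (by omega) _ ht).2
  have hNh : 0 ≤ (N : ℝ) ^ h := Real.rpow_nonneg (by linarith) h
  have hsplit : (N : ℝ) ^ (h + 2) = (N : ℝ) ^ h * (N : ℝ) ^ 2 := by
    rw [Real.rpow_add (by linarith), Real.rpow_two]
  have h3 : (N : ℝ) ^ 3 ≤ (N : ℝ) ^ (h + 2) := by
    rw [show (N : ℝ) ^ 3 = (N : ℝ) ^ ((3 : ℕ) : ℝ) from (Real.rpow_natCast _ 3).symm]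
    exact Real.rpow_le_rpow_of_exponent_le hN1 (by norm_num; linarith)
  -- `(N−1)² W ≤ K N^h N²` with `K = 2 max C 0 + max C' 0`
  have hK : ((N : ℝ) - 1) ^ 2 * bathHeatVar ω₂ lam β γ T N (c * (N : ℝ) ^ 2) ≤
      (2 * max C 0 + max C' 0) * ((N : ℝ) ^ h * (N : ℝ) ^ 2) := by
    rw [← hsplit]
    have hV' : heatSpread ω₂ lam β γ T N (c * (N : ℝ) ^ 2) ≤ max C 0 * (N : ℝ) ^ (h + 2) :=
      hV.trans (mul_le_mul_of_nonneg_right (le_max_left _ _) (Real.rpow_nonneg (by linarith) _))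
    have hC'' : C' * (N : ℝ) ^ 3 ≤ max C' 0 * (N : ℝ) ^ (h + 2) :=
      (mul_le_mul_of_nonneg_right (le_max_left _ _) (by positivity)).trans
        (mul_le_mul_of_nonneg_left h3 (le_max_right _ _))
    nlinarith
  have hW : bathHeatVar ω₂ lam β γ T N (c * (N : ℝ) ^ 2) * (N : ℝ) ^ 2 ≤
      4 * (2 * max C 0 + max C' 0) * (N : ℝ) ^ h * (N : ℝ) ^ 2 := by
    by_cases hw : bathHeatVar ω₂ lam β γ T N (c * (N : ℝ) ^ 2) ≤ 0
    · have : 0 ≤ 4 * (2 * max C 0 + max C' 0) * (N : ℝ) ^ h * (N : ℝ) ^ 2 := by positivity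
      nlinarith
    · have hw : 0 < bathHeatVar ω₂ lam β γ T N (c * (N : ℝ) ^ 2) := not_le.mp hw
      have hq : (N : ℝ) ^ 2 ≤ 4 * ((N : ℝ) - 1) ^ 2 := by nlinarith
      nlinarith [mul_le_mul_of_nonneg_left hq hw.le]
  have hN2pos : (0 : ℝ) < (N : ℝ) ^ 2 := by positivity
  have := le_of_mul_le_mul_right (by linarith [hW] : bathHeatVar ω₂ lam β γ T N (c * (N : ℝ) ^ 2) * (N : ℝ) ^ 2 ≤
    4 * (2 * max C 0 + max C' 0) * (N : ℝ) ^ h * (N : ℝ) ^ 2) hN2pos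
  linarith

/-- ★ **TRANSFER (BHᴾ_h) ⟹ (HSᴾ_{h+2})** for `h ≥ 1` (`V_N ≤ 2(N−1)²W_N + C·N³`). [this cell] -/
theorem heatSpreadPoint_of_bathHeatPoint {h : ℝ} (hh : 1 ≤ h) (hB : BathHeatPoint h) : HeatSpreadPoint (h + 2) := by
  intro ω₂ lam β γ hω hl hβ hγ T hT
  obtain ⟨C, c, hc, N₀, hCN⟩ := hB ω₂ lam β γ hω hl hβ hγ T hT
  obtain ⟨C', hC'⟩ := heatSpread_bathHeatVar_compare hω hl hβ hγ hT
  refine ⟨2 * max C 0 + max C' 0, c, hc, max N₀ 2, fun N hN => ?_⟩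
  have hNN₀ : N₀ ≤ N := le_trans (le_max_left _ _) hN
  have hN2 : 2 ≤ N := le_trans (le_max_right _ _) hN
  have hNr : (2 : ℝ) ≤ N := by exact_mod_cast hN2
  have hN1 : (1 : ℝ) ≤ N := by linarith
  have ht : (0 : ℝ) ≤ c * (N : ℝ) ^ 2 := by positivity
  have hW := hCN N hNN₀
  have h1 := (hC' N (by omega) _ ht).1
  have hNh : 0 ≤ (N : ℝ) ^ h := Real.rpow_nonneg (by linarith) h
  have hsplit : (N : ℝ) ^ (h + 2) = (N : ℝ) ^ h * (N : ℝ) ^ 2 := by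
    rw [Real.rpow_add (by linarith), Real.rpow_two]
  have h3 : (N : ℝ) ^ 3 ≤ (N : ℝ) ^ (h + 2) := by
    rw [show (N : ℝ) ^ 3 = (N : ℝ) ^ ((3 : ℕ) : ℝ) from (Real.rpow_natCast _ 3).symm]
    exact Real.rpow_le_rpow_of_exponent_le hN1 (by norm_num; linarith)
  have hW' : bathHeatVar ω₂ lam β γ T N (c * (N : ℝ) ^ 2) ≤ max C 0 * (N : ℝ) ^ h :=
    hW.trans (mul_le_mul_of_nonneg_right (le_max_left _ _) hNh)
  have hq : ((N : ℝ) - 1) ^ 2 ≤ (N : ℝ) ^ 2 := by nlinarith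
  have hA : ((N : ℝ) - 1) ^ 2 * bathHeatVar ω₂ lam β γ T N (c * (N : ℝ) ^ 2) ≤ max C 0 * ((N : ℝ) ^ h * (N : ℝ) ^ 2) := by
    have := mul_le_mul_of_nonneg_left hW' (sq_nonneg ((N : ℝ) - 1))
    nlinarith [mul_le_mul_of_nonneg_left hq (mul_nonneg (le_max_right C 0) hNh)]
  have hC'' : C' * (N : ℝ) ^ 3 ≤ max C' 0 * (N : ℝ) ^ (h + 2) :=
    (mul_le_mul_of_nonneg_right (le_max_left _ _) (by positivity)).trans
      (mul_le_mul_of_nonneg_left h3 (le_max_right _ _))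
  rw [hsplit] at hC'' ⊢
  nlinarith

/-- ★ **(HSᴾ_{h+2}) ⟺ (BHᴾ_h)** (`h ≥ 1`): the blocker's variance ladder and the bath-heat ladder are ONE ladder. [this cell] -/
theorem heatSpreadPoint_iff_bathHeatPoint {h : ℝ} (hh : 1 ≤ h) : HeatSpreadPoint (h + 2) ↔ BathHeatPoint h :=
  ⟨bathHeatPoint_of_heatSpreadPoint hh, heatSpreadPoint_of_bathHeatPoint hh⟩

/-- ★ **(S) ⟹ (BHᴾ_1)**: the (S) branch gives normal bath heat exchange `W_N(cN²) = O(N)` (via `(S) ⟹ HSᴾ_3`, NODE 105). [this cell] -/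
theorem bathHeatPoint_one_of_subdiffusiveBondHeat (hS : SubdiffusiveBondHeat) : BathHeatPoint 1 := by
  have h := heatSpreadPoint_three_of_subdiffusiveBondHeat hS
  rw [show (3 : ℝ) = 1 + 2 by norm_num] at h
  exact bathHeatPoint_of_heatSpreadPoint le_rfl h

/-- ★ **Free rung (BHᴾ_3)** (`⟺ HSᴾ_5`, `heatSpreadPoint_five`). [folklore] -/
theorem bathHeatPoint_three : BathHeatPoint 3 := by
  have h := heatSpreadPoint_five
  rw [show (5 : ℝ) = 3 + 2 by norm_num] at h
  exact bathHeatPoint_of_heatSpreadPoint (by norm_num) h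

/-- ★ **(S) ⟹ (11071 ⟺ (BTᶠ_1))**: on the (S) branch the blocker IS the floor on the bath kinetic memory tail. [this cell] -/
theorem boundedResponse_iff_bathTailFloor_of_subdiffusiveBondHeat (hS : SubdiffusiveBondHeat) : BoundedResponse ↔ BathTailFloor 1 :=
  boundedResponse_iff_bathTailFloor_of_bathHeatPoint (bathHeatPoint_one_of_subdiffusiveBondHeat hS)

/-- **(BHᴾ_1) ∧ (BTᶠ_1) ⟹ (HSᴾ_3) ∧ (TCᶜ_3)**: the bath pair implies the NODE-104 pair (door + necessity of the ceiling). [this cell] -/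
theorem heatSpreadPoint_gkTailCeiling_of_bath (hP : BathHeatPoint 1) (hF : BathTailFloor 1) :
    HeatSpreadPoint 3 ∧ GKTailCeiling 3 := by
  refine ⟨?_, gkTailCeiling_three_of_boundedResponse (boundedResponse_of_bathHeatPoint_bathTailFloor hP hF)⟩
  have h := heatSpreadPoint_of_bathHeatPoint le_rfl hP
  rwa [show (1 : ℝ) + 2 = 3 by norm_num] at h

/-- **(BHᴾ_g) ⟹ (BTᶜ_g)** for every `g` (`B_N ≤ W_N/2`). [folklore] -/
theorem bathTailCeiling_of_bathHeatPoint_forall {g : ℝ}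
    (hP : ∀ ω₂ lam β γ : ℝ, 0 < ω₂ → 0 < lam → 0 < β → 0 < γ → ∀ T : ℝ, 0 < T → ∀ c : ℝ, 0 < c →
      ∃ C : ℝ, ∃ N₀ : ℕ, ∀ N : ℕ, N₀ ≤ N → bathHeatVar ω₂ lam β γ T N (c * (N : ℝ) ^ 2) ≤ C * (N : ℝ) ^ g) :
    BathTailCeiling g := by
  intro ω₂ lam β γ hω hl hβ hγ T hT c hc
  obtain ⟨C, N₀, hCN⟩ := hP ω₂ lam β γ hω hl hβ hγ T hT c hc
  refine ⟨C / 2, max N₀ 2, fun N hN => ?_⟩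
  have hNN₀ : N₀ ≤ N := le_trans (le_max_left _ _) hN
  have h := bathTail_le hω hl hβ hγ hT (show 1 < N by omega) (t := c * (N : ℝ) ^ 2) (by positivity)
  have hW := hCN N hNN₀
  linarith

/-- ★ **11071 ∧ (BTᶜ_1) ⟹ (BHᴾ_1)** (`W_N/2 = cN²γT²E_N + B_N ≤ cγT²C₁⁺N + C·N`): with the blocker, normal bath heat exchange IS the bath tail
ceiling — the bath twin of `heatSpreadPoint_three_of_boundedResponse_gkTailFloor`. [this cell] -/
theorem bathHeatPoint_one_of_boundedResponse_bathTailCeiling (hB : BoundedResponse) (hC : BathTailCeiling 1) : BathHeatPoint 1 := by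
  intro ω₂ lam β γ hω hl hβ hγ T hT
  obtain ⟨C₁, N₀, hC₁⟩ := (ohmicFloor_iff_boundedResponse.2 hB) ω₂ lam β γ hω hl hβ hγ T hT
  obtain ⟨C, N₁, hCN⟩ := hC ω₂ lam β γ hω hl hβ hγ T hT 1 one_pos
  refine ⟨2 * (γ * T ^ 2 * max C₁ 0 + C), 1, one_pos, max N₀ (max N₁ 1), fun N hN => ?_⟩
  have hNN₀ : N₀ ≤ N := le_trans (le_max_left _ _) hN
  have hNN₁ : N₁ ≤ N := le_trans (le_max_left _ _) (le_trans (le_max_right _ _) hN)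
  have hN1 : 1 ≤ N := le_trans (le_max_right _ _) (le_trans (le_max_right _ _) hN)
  have hNpos : (0 : ℝ) < N := by exact_mod_cast hN1
  have hE := hC₁ N hNN₀
  have hBt := hCN N hNN₁
  rw [Real.rpow_one] at hBt ⊢
  have h := bathHeatVar_eq_escapeDeficit_add_bathTail hω hl hβ hγ hT (show 0 < N by omega) (t := 1 * (N : ℝ) ^ 2) (by positivity)
  have hE' : escapeDeficit ω₂ lam β γ T N * N ≤ max C₁ 0 := by
    have h1 : escapeDeficit ω₂ lam β γ T N ≤ max C₁ 0 / N := hE.trans (div_le_div_of_nonneg_right (le_max_left _ _) hNpos.le)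
    rwa [le_div_iff₀ hNpos] at h1
  have key : 1 * (N : ℝ) ^ 2 * (γ * T ^ 2 * escapeDeficit ω₂ lam β γ T N) ≤ γ * T ^ 2 * max C₁ 0 * N := by
    have := mul_le_mul_of_nonneg_left hE' (show (0 : ℝ) ≤ γ * T ^ 2 * N by positivity)
    nlinarith
  linarith

/-- **11071 modulo the two-sided bath tail control**: `BathTailCeiling 1 → BathTailFloor 1 → (BoundedResponse ↔ BathHeatPoint 1)` — given
`|B_N(cN²)| = O(N)`, the blocker IS normal bath heat exchange (and `⟺ HSᴾ_3`). [this cell] -/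
theorem boundedResponse_iff_bathHeatPoint_of_bathTail (hC : BathTailCeiling 1) (hF : BathTailFloor 1) :
    BoundedResponse ↔ BathHeatPoint 1 :=
  ⟨fun hB => bathHeatPoint_one_of_boundedResponse_bathTailCeiling hB hC, fun hP => boundedResponse_of_bathHeatPoint_bathTailFloor hP hF⟩

end Door

end Summit.AtomisticToContinuum.FouriersLaw.Theorems.BoundedResponse.HeatSpreading

end
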